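import Mathlib
import HarnessLib
import Literature.MathematicalPhysics.StatisticalMechanics.LinearisedMapABKMContractionQ
import Literature.MathematicalPhysics.StatisticalMechanics.LinearisedMapKernelSubRay

/-!
# [ABKM19] Lemma 10.1 for the DIFFERENCE of two step kernels, torus data
# (`‖C_k^{(q)}K − C_k^{(q')}K‖_{k+1}^{(A)} ≤ ℓ·(L^d A𝒫' c + ε(A))·‖K‖_k^{(A)}`; Lemma 12.6 (12.53), linear part)

Two-kernel twin of `LinearisedMapABKMContractionQ.weakNormLE_opC_abkm_of_stepKernelBounds`: the same
discharge of the box / gauge / weight hypotheses for the concrete parameters `abkmNormParams`, with the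
single-kernel integration property replaced by the `ℓ = 1` property of the PAIR (hypothesis `hdint`,
constant `C·ℓ·A𝒫'^{|X|_k}`; supplied by `FluctuationKernelComparisonProperty.tayNormLE_fluct_sub_fluct_pow_abkm`
with `ℓ = (r₀+1)·gaussCompConst·δ`, `A𝒫' = A𝒫p^{1/p}`), via `LinearisedMapKernelSubRay.weakNormLE_opC_sub_of_ray`:

* **`weakNormLE_opC_sub_abkm_of_stepKernelBounds`** —
  `‖opC Da K − opC Db K‖_{k+1}^{(A)} ≤ C · (L^d · ℓA𝒫' · abkmContrConst d L R + ℓ · largePartEps d L A A𝒫' η)`.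

Everything is proved; no named fact.

## References
* S. Adams, S. Buchholz, R. Kotecký, S. Müller, arXiv:1910.13564, Lemma 10.1, Lemma 12.6 (12.53)
  [AdamsBuchholzKoteckyMuller2019].
-/

noncomputable section

namespace Literature.MathematicalPhysics.StatisticalMechanics.GradientRG

open scoped BigOperators Classical
open Finset MeasureTheory
open Literature.MathematicalPhysics.StatisticalMechanics.TorusPolymer
  (IsPolymer blocks blockOf thicken reblock closure mem_blocks numBlocks isPolymer_blockOf
    card_blocks_eq_numBlocks boxCorner card_blockOf subset_thicken)
open Literature.Barriers.CriticalPhenomena.LongRangePhi4.Polymer (IsConn)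
open Literature.MathematicalPhysics.QuantumFieldTheory

variable {d M : ℕ} [NeZero M]

/-- **[ABKM19] Lemma 10.1 for the DIFFERENCE of two step kernels, torus data** (two-kernel twin of
`weakNormLE_opC_abkm_of_stepKernelBounds`): for two step data of scale `k` sharing `s, L, B₀, c₀` whose
kernels satisfy `StepKernelBounds`, the `ℓ = 1` integration property of the pair with constants `ℓ, κ = A𝒫'`
(`hdint`; e.g. `FluctuationKernelComparisonProperty.tayNormLE_fluct_sub_fluct_pow_abkm`), and a
translation-invariant local `C^{r₀}` activity with `‖K‖_k^{(A)} ≤ C`: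
`‖C_a K − C_b K‖_{k+1}^{(A)} ≤ C · (L^d · ℓ A𝒫' · abkmContrConst d L R + ℓ ε(A))`, `ε = largePartEps d L A A𝒫' η` —
the part of `S_a(H,K) − S_b(H,K)` linear in `K` (hypothesis (12.53) of Lemma 12.6).
[cite: AdamsBuchholzKoteckyMuller2019, Lemma 10.1 / Lemma 12.6 (12.53)] -/
theorem weakNormLE_opC_sub_abkm_of_stepKernelBounds {L N Mord R n p r₀ : ℕ}
    {θbar lam μ δ₁ δ₀ A𝒫 A𝒫' A𝒫a A𝒫b C₂ C₂b h A : ℝ}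
    {𝒞 : ℕ → (Fin d → ZMod M) → ℝ} (hd : 3 ≤ d) (hLodd : Odd L) (hL : 2 ^ (d + 3) + 16 * R ≤ L)
    (hM : M = L ^ N) {k : ℕ} (hkN : k + 1 ≤ N) (hp : d / 2 + 2 ≤ p) (hpM : p + d ≤ Mord)
    (hMR : Mord ≤ R) (hr₀ : 3 ≤ r₀)
    (hB : AbkmWeightBounds L N Mord R n θbar lam μ δ₁ δ₀ A𝒫 𝒞
      (abkmWeightData L N Mord R θbar (schedDelta δ₀ δ₁ N) 𝒞))
    (hδ₀ : 0 < δ₀) (hδ₁ : 0 < δ₁) (hh : 0 < h) (hh0 : hZeroSq d R δ₀ δ₁ ≤ h ^ 2)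
    (hA𝒫 : 0 ≤ A𝒫') (hA : 1 ≤ A) (hA𝒫A : A𝒫' ≤ A) {η : ℝ} (hη : 0 < η)
    (hsmall : (2 : ℝ) ^ (L ^ d) * (A𝒫' * A ^ (-(1 - η⁻¹) : ℝ)) ≤ 1)
    (hgain : ∀ X : Finset (Fin d → ZMod M), IsPolymer (L ^ k) X → IsConn X →
      2 ^ d < (blocks (L ^ k) X).card →
        η * ((blocks (L * L ^ k) (closure (L * L ^ k) X)).card : ℝ) ≤ (blocks (L ^ k) X).card)
    -- the two step data of scale `k` (same `s, L, B₀, c₀`)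
    (D Db : StepData d M) (hDs : D.s = L ^ k) (hDL : D.L = L)
    (hS : StepKernelBounds (abkmWeightData L N Mord R θbar (schedDelta δ₀ δ₁ N) 𝒞) L k A𝒫a C₂ D.𝒞)
    (hSb : StepKernelBounds (abkmWeightData L N Mord R θbar (schedDelta δ₀ δ₁ N) 𝒞) L k A𝒫b C₂b Db.𝒞)
    (hDbs : Db.s = D.s) (hDbL : Db.L = D.L) (hDbB : Db.B₀ = D.B₀) (hDbc : Db.c₀ = D.c₀)
    {x₀ : Fin d → ZMod M} (hB₀ : D.B₀ = blockOf (L ^ k) x₀)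
    (hc₀ : D.c₀ = boxCorner (L ^ k) (starRad R L d k) x₀)
    -- the `ℓ = 1` integration property of the pair
    {ℓ : ℝ} (hℓ : 0 ≤ ℓ)
    (hdint : ∀ X : Finset (Fin d → ZMod M), IsPolymer (L ^ k) X → IsConn X →
      ∀ (F : ((Fin d → ZMod M) → ℝ) → ℂ) (C : ℝ), 0 ≤ C → ContDiff ℝ r₀ F →
        IsGaugeLocal ((abkmNormParams L N Mord R p r₀ h θbar A (schedDelta δ₀ δ₁ N) 𝒞).gauge k X) F →
        TayNormLE ((abkmNormParams L N Mord R p r₀ h θbar A (schedDelta δ₀ δ₁ N) 𝒞).gauge k X) r₀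
          ((abkmWeightData L N Mord R θbar (schedDelta δ₀ δ₁ N) 𝒞).weight k X) F C →
          TayNormLE ((abkmNormParams L N Mord R p r₀ h θbar A (schedDelta δ₀ δ₁ N) 𝒞).gauge k X) r₀
            ((abkmWeightData L N Mord R θbar (schedDelta δ₀ δ₁ N) 𝒞).midWeight k X)
            (fluct D.𝒞 F - fluct Db.𝒞 F) (C * ℓ * A𝒫' ^ numBlocks (L ^ k) X))
    -- the activity
    {K : Finset (Fin d → ZMod M) → ((Fin d → ZMod M) → ℝ) → ℂ} {C : ℝ} (hC : 0 ≤ C)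
    (hK : WeakNormLE (abkmNormParams L N Mord R p r₀ h θbar A (schedDelta δ₀ δ₁ N) 𝒞) k K C)
    (hKt : TransInv (L ^ k) K) (hKd : ∀ X, ContDiff ℝ r₀ (K X))
    (hKloc : ∀ X, IsPolymer (L ^ k) X → IsConn X →
      IsGaugeLocal ((abkmNormParams L N Mord R p r₀ h θbar A (schedDelta δ₀ δ₁ N) 𝒞).gauge k X) (K X))
    (hRd : ∀ X, ContDiff ℝ r₀ (fluct D.𝒞 (K X))) (hRb : ∀ X, ContDiff ℝ r₀ (fluct Db.𝒞 (K X))) :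
    WeakNormLE (abkmNormParams L N Mord R p r₀ h θbar A (schedDelta δ₀ δ₁ N) 𝒞) (k + 1) (opC D K - opC Db K)
      (C * ((L : ℝ) ^ d * ((ℓ * A𝒫') * abkmContrConst d L R) + ℓ * largePartEps d L A A𝒫' η)) := by
  set P := abkmNormParams L N Mord R p r₀ h θbar A (schedDelta δ₀ δ₁ N) 𝒞 with hP
  -- sizes
  have h8 : 8 ≤ 2 ^ (d + 3) := by
    calc 8 = 2 ^ 3 := by norm_num
      _ ≤ 2 ^ (d + 3) := Nat.pow_le_pow_right (by norm_num) (by omega)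
  have h2dle : 2 ^ d ≤ 2 ^ (d + 3) := Nat.pow_le_pow_right (by norm_num) (by omega)
  have hL4 : 4 ≤ L := by omega
  have hLR : 2 ^ d + R ≤ L := by omega
  have hL0 : (0 : ℝ) < L := by exact_mod_cast hLodd.pos
  have hL1 : (1 : ℝ) ≤ L := by exact_mod_cast hLodd.pos
  have hpR : p ≤ R := by omega
  have hd2 : 2 ≤ d := by omega
  -- the torus at scale `k + 1`
  obtain ⟨t, ht⟩ : ∃ t, N = (k + 1) + t := ⟨N - (k + 1), by omega⟩
  have hMt : M = P.L ^ (k + 1) * L ^ t := by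
    show M = L ^ (k + 1) * L ^ t
    rw [← pow_add, ← ht]; exact hM
  have htodd : Odd (L ^ t) := hLodd.pow
  -- the step data
  have hDs' : D.s = P.L ^ k := hDs
  have hDL' : D.L = P.L := hDL
  have hB₀' : D.B₀ = blockOf (P.L ^ k) x₀ := hB₀
  have hc₀' : D.c₀ = boxCorner (P.L ^ k) (P.rad k) x₀ := hc₀
  -- kernel facts from Theorem 7.1
  have hk1 : k + 1 ≤ N + 1 := by omega
  have hC𝒞 : (Matrix.circulant D.𝒞).PosSemidef := hS.posSemidef
  have hC𝒞b : (Matrix.circulant Db.𝒞).PosSemidef := hSb.posSemidef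
  -- the gauges of the two scales
  have h𝔥k : 0 < P.𝔥 k := fieldWt_pos hh hL0 d k
  have h𝔥 : 0 < P.𝔥 (k + 1) := fieldWt_pos hh hL0 d (k + 1)
  have hsucc : P.𝔥 (k + 1) = scaleRatio d L * P.𝔥 k := fieldWt_succ_nat hLodd.pos d k
  have hκL := scaleRatio_pos (d := d) hLodd.pos
  have hκL1 := scaleRatio_le_one hd hL4
  have h𝔥le : P.𝔥 (k + 1) ≤ P.𝔥 k := by
    rw [hsucc]; exact mul_le_of_le_one_left h𝔥k.le hκL1
  have hκ₁ : P.𝔥 (k + 1) ≤ scaleRatio d L * P.𝔥 k := hsucc.le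
  have hR : 0 < P.R k := by show (0 : ℝ) < (L : ℝ) ^ k; positivity
  have hRsucc : P.R (k + 1) = P.L * P.R k := by
    show (L : ℝ) ^ (k + 1) = (L : ℕ) * (L : ℝ) ^ k; rw [pow_succ']
  have hratio : P.𝔥 (k + 1) / P.𝔥 k * (P.R k / P.R (k + 1)) = scaleRatio d L / (P.L : ℝ) := by
    show fieldWt h (L : ℝ) d (k + 1) / fieldWt h (L : ℝ) d k * ((L : ℝ) ^ k / (L : ℝ) ^ (k + 1)) =
      scaleRatio d L / L
    rw [fieldWt_succ_nat hLodd.pos d k, pow_succ']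
    exact two_scale_ratio (fieldWt_pos hh hL0 d k) (by positivity) hL0
  have hθ : P.𝔥 (k + 1) / P.𝔥 k * (P.R k / P.R (k + 1)) ≤ 1 := by
    rw [hratio]
    show scaleRatio d L / (L : ℝ) ≤ 1
    rw [div_le_one hL0]
    exact hκL1.trans hL1
  have hp' : d / 2 + 2 ≤ P.p := hp
  have hr₀' : 3 ≤ P.r₀ := hr₀
  have hrad : P.rad k ≤ P.rad (k + 1) := starRad_le_succ hLR k
  have hrad' : P.rad k + (2 ^ d - 1) * P.L ^ k ≤ P.rad (k + 1) := starRad_add_le_succ hLR k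
  -- the box `B*`
  have hbox := two_mul_box_add_le (d := d) hL hpR k
  have hside := boxSide_le (d := d) hL k
  have hLN : L ^ (k + 1) ≤ M := by rw [hM]; exact Nat.pow_le_pow_right hLodd.pos hkN
  have hLk1 : 1 ≤ L ^ k := Nat.one_le_pow _ _ hLodd.pos
  have hdiv : 2 * ((L ^ k - 1) / 2) + 1 ≤ L ^ k := by
    have := Nat.mul_div_le (L ^ k - 1) 2; omega
  have hwrap : 4 * ((P.L ^ k - 1) / 2 + P.rad k) < M := by
    show 4 * ((L ^ k - 1) / 2 + starRad R L d k) < M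
    omega
  have hroom : ((2 * ((P.L ^ k - 1) / 2 + P.rad k) : ℕ) + (P.p : ℤ)) * 2 < M := by
    show ((2 * ((L ^ k - 1) / 2 + starRad R L d k) : ℕ) + (p : ℤ)) * 2 < (M : ℤ)
    have h2 : (2 * ((L ^ k - 1) / 2 + starRad R L d k) + p) * 2 < M := by omega
    exact_mod_cast h2
  have hC₁ : (0 : ℝ) ≤ ((2 * R + 2 : ℕ) : ℝ) := Nat.cast_nonneg _
  have hρ : ((2 * ((P.L ^ k - 1) / 2 + P.rad k) : ℕ) : ℝ) ≤ ((2 * R + 2 : ℕ) : ℝ) * P.R k := by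
    show ((2 * ((L ^ k - 1) / 2 + starRad R L d k) : ℕ) : ℝ) ≤ ((2 * R + 2 : ℕ) : ℝ) * (L : ℝ) ^ k
    exact_mod_cast hside
  have hC₀ : (1 : ℝ) ≤ ((2 * R + 2 : ℕ) : ℝ) + ((d / 2 + 1 : ℕ) : ℝ) := by
    have : (1 : ℝ) ≤ ((2 * R + 2 : ℕ) : ℝ) := by exact_mod_cast (show 1 ≤ 2 * R + 2 by omega)
    linarith [(Nat.cast_nonneg (d / 2 + 1) : (0 : ℝ) ≤ _)]
  have hρ0 : ((2 * ((P.L ^ k - 1) / 2 + P.rad k) : ℕ) : ℝ) + (d / 2 + 1 : ℕ) ≤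
      (((2 * R + 2 : ℕ) : ℝ) + ((d / 2 + 1 : ℕ) : ℝ)) * P.R k := by
    have hLk : (1 : ℝ) ≤ (L : ℝ) ^ k := one_le_pow₀ hL1
    have h1 : ((d / 2 + 1 : ℕ) : ℝ) ≤ ((d / 2 + 1 : ℕ) : ℝ) * (L : ℝ) ^ k :=
      le_mul_of_one_le_right (Nat.cast_nonneg _) hLk
    calc ((2 * ((P.L ^ k - 1) / 2 + P.rad k) : ℕ) : ℝ) + (d / 2 + 1 : ℕ)
        ≤ ((2 * R + 2 : ℕ) : ℝ) * P.R k + ((d / 2 + 1 : ℕ) : ℝ) * (L : ℝ) ^ k := add_le_add hρ h1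
      _ = (((2 * R + 2 : ℕ) : ℝ) + ((d / 2 + 1 : ℕ) : ℝ)) * P.R k := by
          show ((2 * R + 2 : ℕ) : ℝ) * (L : ℝ) ^ k + _ = _ * (L : ℝ) ^ k; ring
  -- the three discharged hypothesis shapes and the weights
  have hWd := hB.dominated
  have hWm := hB.monotone
  have hw6 : NextWeightDominates P k := nextWeightDominates_abkm hB hLodd hLR hMt htodd p r₀ h A
  have hw9 : ∀ U, IsPolymer (P.L ^ (k + 1)) U → W9At P k U := fun U hU =>
    w9At_abkm hd2 hLodd hL hM hkN hpM hB hδ₀ hδ₁ hh hh0 r₀ A hU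
  have hdint' : ∀ X : Finset (Fin d → ZMod M), IsPolymer (P.L ^ k) X → IsConn X →
      ∀ (F : ((Fin d → ZMod M) → ℝ) → ℂ) (C : ℝ), 0 ≤ C → ContDiff ℝ P.r₀ F →
        IsGaugeLocal (P.gauge k X) F → TayNormLE (P.gauge k X) P.r₀ (P.W.weight k X) F C →
          TayNormLE (P.gauge k X) P.r₀ (P.W.midWeight k X) (fluct D.𝒞 F - fluct Db.𝒞 F)
            (C * ℓ * A𝒫' ^ numBlocks (P.L ^ k) X) := hdint
  -- Lemma 10.1 for the pair (ray form)
  have hmain := weakNormLE_opC_sub_of_ray P hMt hLodd htodd D Db hDs' hDL' hB₀' hc₀' hC𝒞 hDbs hDbL hDbB hDbc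
    hC𝒞b h𝔥 h𝔥le hκ₁ hR hRsucc hθ hp' hr₀' hrad hrad' hwrap hroom hC₁ hρ hC₀ hρ0 hWd hWm hw6 hw9 hℓ hA𝒫
    hA𝒫A hA hη hdint' hsmall hgain hC hK (by rwa [hDs]) hKd hKloc (by exact hRd) (by exact hRb)
  -- the constant is `k`-independent
  have hconst : 1536 * (ℓ * A𝒫') * blockContrConst d (P.𝔥 k) (P.𝔥 (k + 1)) (P.R k) (P.R (k + 1)) P.L
      (scaleRatio d L) ((2 * R + 2 : ℕ) : ℝ) (((2 * R + 2 : ℕ) : ℝ) + ((d / 2 + 1 : ℕ) : ℝ)) =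
      (ℓ * A𝒫') * abkmContrConst d L R := by
    rw [blockContrConst_eq_of_ratio d hratio]
    show 1536 * (ℓ * A𝒫') * blockContrConst d 1 (scaleRatio d L) 1 (L : ℝ) (L : ℝ) (scaleRatio d L)
        ((2 * R + 2 : ℕ) : ℝ) (((2 * R + 2 : ℕ) : ℝ) + ((d / 2 + 1 : ℕ) : ℝ)) =
      (ℓ * A𝒫') * (1536 * blockContrConst d 1 (scaleRatio d L) 1 (L : ℝ) (L : ℝ) (scaleRatio d L)
        ((2 * R + 2 : ℕ) : ℝ) (((2 * R + 2 : ℕ) : ℝ) + ((d / 2 + 1 : ℕ) : ℝ)))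
    ring
  rw [hconst] at hmain
  exact hmain

end Literature.MathematicalPhysics.StatisticalMechanics.GradientRG

end
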